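/-
Origin: expansion seat `planner-pub-hodgecm-mc-axioms-1-g14-0`, handover #W138 2026-08-20T15:53:55Z md5 5e100c473b3e (PKG 962b55056b65 → 5e100c473b3e; 197 l.; MECHANICAL (iib-R) rewrite v3.1 of the PKG file as it stands (136 token edits; rules R1x1+R5x1+RX[h₂]x134)) (`HOME/mc/pub-hodgecm-mc-axioms-1-g14/revendor/kit-r55/stage55/HodgeCM/Model/E2InstanceR6.lean`, md5 5e100c473b3e, 197 lines);
landed by the gen-22 packager (p-g22) in gate run 55 REPLACES the earlier landed copy of `HodgeCM/Model/E2InstanceR6.lean` (seat copy carried the packager Origin header of an earlier run (stripped)).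
-/
/-
Origin: CONSTRUCTION seat `planner-pub-hodgecm-mc-glue-1-g6-0` (unit pub-hodgecm-mc-glue-1-g6, gen 6 of mc-glue-1, node E ASSEMBLER), 2026-08-19T18:00Z — revision (§60) of `HodgeCM/Model/E2InstanceR6.lean` for RUN 37: the (Θ-sat-≤) ORDER CASCADE (BINDER-TRIAGE §60: theta saturation in the `K`-order `Γ' ≤ Γ :↔ Γ'.K ≤ Γ.K` of the (W1) `Level`-pair root, covers `cover Γ Γ' (Level.Γ_mono h)`), forced by the K-order `Model.thetaSatOf` (theta-3-g9 t37 #C2); kit `mc/pub-hodgecm-mc-glue-1-g6/t37c-mcglue1g6.txt`; base PKG (RUN-35 bytes, glue-1 lineage). REPLACE — binder `thetaSat` of `perL_picardCM_r6` re-typed `(hle : Γ'.Γ ≤ Γ.Γ)` ↦ `(hle : Γ' ≤ Γ)` with `coverOf … hA Γ Γ' (Level.Γ_mono hle)` (1 binder); :176 hands it to `ballFactsOf` unchanged. Kernel only: 0 `proof-hole`, 0 new declarations, cites nothing new; expected `#print axioms` unchanged (⊆ {propext, Classical.choice, Quot.sound}).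
-/
/-
Origin: expansion seat `planner-pub-hodgecm-mc-glue-1-g3-0`, handover #303 2026-08-19T00:32Z md5 5e1af491f0bea83dbf0c6ba7490d6731 (NEW PKG leaf, 186 l.; node E END STATE revision 6 `Model.perL_picardCM_r6` : (picardCMUniverse hHD hI h₁ h₃).PerL at T := thetaModelOf … h (embOf …) (coverOf … hA) wm (thetaOf _ I) (d12Of μ) (d34Of μ); built on the bottom `Model.perL_picardCM` composing the R2–R5 substitutions; vs R5: ball/ballFacts := period-1-g3 `Model.ballOf`/`ball (`HOME/mc/pub-hodgecm-mc-glue-1-g3/lean/E2InstanceR6.lean`, md5 5e1af491, 186 lines);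
landed by the gen-9 packager (p-g9) in gate run 33 as `HodgeCM/Model/E2InstanceR6.lean` (verbatim).
-/
/-
Origin: CONSTRUCTION seat `planner-pub-hodgecm-mc-glue-1-g3-0` (unit pub-hodgecm-mc-glue-1-g3, gen 3 of mc-glue-1,
node E ASSEMBLER), 2026-08-19.  NEW additive leaf `HodgeCM/Model/E2InstanceR6.lean`.  Imports: `E2InstanceR5` (the
R2–R5 chain and its junctions), `EmbPetersson` (node E packet V-pet: the Petersson half of C2 in kernel),
`BallInstance` (mc-period-1-g3, node (P′): `Model.ballOf` / `Model.ballFactsOf`), `SupplyClassLevel` (mc-theta-3-g3,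
J-W7a level-indexed class supply packs — the (J-fam) repair of record), `OccInstance` (mc-binder-2-g3, node (v20):
`Model.occOf`), `ThetaSideInstance` (mc-period-2-g4, node (v21): `Model.thetaOf` / `d12Of` / `d34Of`),
`Proofs.LandherrCompact` (anisotropy decided by the degree).  No proof holes; every undischarged
input is an explicit binder.  Expected `#print axioms`: {propext, Classical.choice, Quot.sound}.
-/
import Summits.HodgeConjecture.HodgeCM.Model.E2InstanceR5
import Summits.HodgeConjecture.HodgeCM.Model.EmbPetersson
import Summits.HodgeConjecture.HodgeCM.Model.BallInstance
import Summits.HodgeConjecture.HodgeCM.Model.SupplyClassLevel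
import Summits.HodgeConjecture.HodgeCM.Model.OccInstance
import Summits.HodgeConjecture.HodgeCM.Model.ThetaSideInstance
import Summits.HodgeConjecture.HodgeCM.Proofs.LandherrCompact

/-!
# E2 instance, revision 6: `ball`/`ballFacts`/`occ` PRODUCED, `Theta`/`d12`/`d34` PINNED, `innerEmb` REDUCED, `classPacks` RE-INDEXED

`Model.perL_picardCM_r6` is the END-STATE theorem `U.PerL` for the Picard–CM model universe
`U := picardCMUniverse hHD hI h₁ h₃` at the CONCRETE theta model
`T := thetaModelOf hHD hI h₁ h₃ h (embOf …) (coverOf … hA) wm (thetaOf _ I) (d12Of μ) (d34Of μ)`, i.e. the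
revision-5 model with the DATA binders `Theta`, `d12`, `d34` PINNED to mc-period-2-g4's values of record
(`HodgeCM/Model/ThetaSideInstance.lean`, vacancy (v21)): `Θ_i(Γ)` = the theta classes of the adelic theta forms of
type index `i` at level `Γ` through the class map of `Γ\𝔹²` (input record `I V c : ThetaClassInput U V c`, to be
instantiated CLASSICALLY per the carvers' ruling (J-lvl′) 2026-08-19T00:25:32Z), and the torus sides of archimedean
types `(-μ₀ c, -μ₁ c)`, `(-μ₂ c, -μ₃ c)` (input `μ`); and with the following binders of `Model.perL_picardCM_r5`
REPLACED by package terms: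

* `ball`, `ballFacts` (PerL Prop. 4.3 uniformisation data and facts; rows 11/12) — by mc-period-1-g3's
  `Model.ballOf … V c hL` / `Model.ballFactsOf …` (`HodgeCM/Model/BallInstance.lean`) in the regime
  `hL : 2 < [L:ℚ]`, which holds at every good sextic context (`Model.two_lt_finrank_of_goodCtx`); of the four
  inputs of `ballFactsOf`, `hsub` is DERIVED here (theta ⊆ isotypic, from `hLiu` and CM inflation exactly as in
  revision 2), `hcov` is the kernel junction `Model.map_coverOf_unif` (revision 3), and `hsat` (theta sets saturated
  under the level covers) and `htransl` (N33b, automorphy transport of theta one-forms) are carried as the binders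
  `thetaSat`, `transl`;
* `innerEmb` (C2, the `emb`-isometry at good contexts) — by `Model.innerEmbAt_of_bettiSide`
  (`HodgeCM/Model/EmbPetersson.lean`: the Petersson half is the kernel theorem `Model.embPeterssonSide_holds`, from
  the tree's unfolding formula and `BallForms.baily1973_10_3`); what remains is the Betti half, carried as the binder
  `hBetti V : Model.EmbBettiSide hHD hI h₁ h₃ V` (= the conclusion of the tree theorem
  `HodgeModel.exists_trC_cup_conj_eq_mul_cintegral_topFormOfClass` at the standard Hodge model; K-tree);
* `occ` (rows A12/A34, occurrence of the archimedean K-types) — by mc-binder-2-g3's `Model.occOf`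
  (`HodgeCM/Model/OccInstance.lean`) from the binders `lin` (linear structure of `wm V c`), `hyp12`, `hyp34`
  (the smooth-vector hypotheses of the two sides);
* `classPacks` is RE-INDEXED per the carvers' ruling (J-lvl)/(J-fam) of 2026-08-19T00:20:57Z: its type now asks for
  mc-theta-3-g3's LEVEL-INDEXED packs `ClassSupplyPackN T V c 0/1` (`HodgeCM/Model/SupplyClassLevel.lean`) instead of
  the fixed-level `ClassSupplyPack` (which has no instance in the intended model); strictly weaker hypothesis — a
  fixed-level pack still converts by `ClassSupplyPack.toN`.

The anisotropy of `V.Hm` needed by C2 is decided by the degree (`HermSpace3.isAnisotropic_iff_finrank_ne_two`).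

Remaining binders: `hHR`, `h`, `hA`, `wm`, `I`, `μ`, `hBetti`, `hd`, `ha`, `hLiu`, `thetaSat`,
`transl`, `classPacks`, `gen12`, `real34`, `lin`, `hyp12`, `hyp34` — of which `wm`, `I`, `μ` are DATA
(producers: mc-unitary-1-g3's `Model.wmOf` and mc-theta-3-g3's claimed `Model.thetaClassInputOf`, substituting by
`rfl` in a later revision) and the rest are propositions / `Nonempty` records about the concrete model.
-/

noncomputable section

open scoped TensorProduct InnerProductSpace Matrix

namespace HodgeCM

namespace Model

open HodgeCM.Universe (AdelicThetaCore AdelicThetaCore₀ SideData ThetaModel ModelAxiomsPerL)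
open Literature.AlgebraicGeometry.HodgeTheory
open Literature.AlgebraicGeometry.ComplexMultiplication (Shimura1998_Thm3_isogenousPower Shimura1998_Thm2_Cor)
open Literature.NumberTheory.Automorphic.PicardCM
open Literature.NumberTheory.Transcendental (Arapura2012_Cor_15_4_6)
open HodgeCM.CMTypeOps (inflate)
open HodgeCM.Model.SupplyInstance (LineSupplyData)
open HodgeCM.Model.SupplyResidual (ClassSupplyPackN)

variable (hHD : exists_isReal_hodgeModel) (hI : hodgePQ_independent_of_hodgeModel)
  (h₁ : BallQuotientUniformised)  (h₃ : CMAbelianVarietyRealised)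

/-- **Theta ⊆ isotypic at good sextic contexts** (the input `hsub` of `Model.ballFactsOf` and the binder `thetaSub`
of `Model.perL_picardCM`), DERIVED — exactly as in revision 2 — from `hLiu` (theta one-forms of type `Ψᵢ` lie in an
isotypic part for an inflated CM type over some CM extension `M ⊇ c.K`) and CM inflation
(`Model.fact_cmInflation_printed`, from Shimura's two printed theorems `hd`, `ha`). -/
theorem thetaSub_of_hLiu (h : Bool) (hA : Arapura2012_Cor_15_4_6)
    (wm : ∀ {L : CMField} {ι₁ : L →+* ℂ} (V : HermSpace3 L ι₁) (c : SeesawCtx L),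
      WeilThetaModel (V.latticeModel printFact_unitaryCompact_holds).toQuotientModel.G
        (V.latticeModel printFact_unitaryCompact_holds).toQuotientModel.Γ
        (c.D.latticeModelW printFact_unitaryCompact_holds).toQuotientModel.G
        (c.D.latticeModelW printFact_unitaryCompact_holds).toQuotientModel.Γ)
    (I : ∀ {L : CMField} {ι₁ : L →+* ℂ} (V : HermSpace3 L ι₁) (c : SeesawCtx L),
      ThetaClassInput (picardCMUniverse hHD hI h₁ h₃) V c)
    (μ : ∀ {L : CMField}, SeesawCtx L → Fin 4 → NumberField.InfinitePlace L → ℤ)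
    (hd : Shimura1998_Thm3_isogenousPower) (ha : Shimura1998_Thm2_Cor)
    (hLiu : ∀ {L : CMField} {ι₁ : L →+* ℂ} (V : HermSpace3 L ι₁) (c : SeesawCtx L),
      (thetaModelOf hHD hI h₁ h₃ h (embOf hHD hI h₁ h₃) (coverOf hHD hI h₁ h₃ hA) wm (thetaOf _ I) (d12Of μ) (d34Of μ)).GoodCtx ι₁ c → Module.finrank ℚ c.K = 6 →
      ∀ (i : Fin 4) (Γ : Level V), ∃ (M : CMField) (k : c.K →+* M) (σ' : M →+* ℂ), σ'.comp k = c.σ ∧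
        (thetaModelOf hHD hI h₁ h₃ h (embOf hHD hI h₁ h₃) (coverOf hHD hI h₁ h₃ hA) wm (thetaOf _ I) (d12Of μ) (d34Of μ)).Theta V c i Γ ⊆
          (picardCMUniverse hHD hI h₁ h₃).Uiso Γ M (inflate k (c.Ψ i)) σ')
    {L : CMField} {ι₁ : L →+* ℂ} (V : HermSpace3 L ι₁) (c : SeesawCtx L)
    (hc : (thetaModelOf hHD hI h₁ h₃ h (embOf hHD hI h₁ h₃) (coverOf hHD hI h₁ h₃ hA) wm (thetaOf _ I) (d12Of μ) (d34Of μ)).GoodCtx ι₁ c) (hK : Module.finrank ℚ c.K = 6) (i : Fin 4) (Γ : Level V) :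
    (thetaModelOf hHD hI h₁ h₃ h (embOf hHD hI h₁ h₃) (coverOf hHD hI h₁ h₃ hA) wm (thetaOf _ I) (d12Of μ) (d34Of μ)).Theta V c i Γ ⊆
      (picardCMUniverse hHD hI h₁ h₃).Uiso Γ c.K (c.Ψ i) c.σ := by
  intro ω hω
  obtain ⟨M, k, σ', hσ, hsub⟩ := hLiu V c hc hK i Γ
  have hle := Universe.Uiso_inflate_le (Model.modelAxiomsPerL hHD hI h₃ h₁).pull_comp
    (Model.fact_alphaLine (hHD := hHD) (hI := hI) (h₁ := h₁) (h₃ := h₃))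
    (fact_cmInflation_printed hHD hI h₃ h₁ hd ha) Γ c.K M k (c.Ψ i) σ' (hsub hω)
  rw [hσ] at hle
  exact hle

/-- **E2 instance, revision 6** (see the module docstring). -/
theorem perL_picardCM_r6 (hHR : BettiUniverse.HodgeRiemann20) (h : Bool)
    (hA : Arapura2012_Cor_15_4_6)
    (wm : ∀ {L : CMField} {ι₁ : L →+* ℂ} (V : HermSpace3 L ι₁) (c : SeesawCtx L),
      WeilThetaModel (V.latticeModel printFact_unitaryCompact_holds).toQuotientModel.G
        (V.latticeModel printFact_unitaryCompact_holds).toQuotientModel.Γ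
        (c.D.latticeModelW printFact_unitaryCompact_holds).toQuotientModel.G
        (c.D.latticeModelW printFact_unitaryCompact_holds).toQuotientModel.Γ)
    (I : ∀ {L : CMField} {ι₁ : L →+* ℂ} (V : HermSpace3 L ι₁) (c : SeesawCtx L),
      ThetaClassInput (picardCMUniverse hHD hI h₁ h₃) V c)
    (μ : ∀ {L : CMField}, SeesawCtx L → Fin 4 → NumberField.InfinitePlace L → ℤ)
    (hBetti : ∀ {L : CMField} {ι₁ : L →+* ℂ} (V : HermSpace3 L ι₁), EmbBettiSide hHD hI h₁ h₃ V)
    (hd : Shimura1998_Thm3_isogenousPower) (ha : Shimura1998_Thm2_Cor)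
    (hLiu : ∀ {L : CMField} {ι₁ : L →+* ℂ} (V : HermSpace3 L ι₁) (c : SeesawCtx L),
      (thetaModelOf hHD hI h₁ h₃ h (embOf hHD hI h₁ h₃) (coverOf hHD hI h₁ h₃ hA) wm (thetaOf _ I) (d12Of μ) (d34Of μ)).GoodCtx ι₁ c → Module.finrank ℚ c.K = 6 →
      ∀ (i : Fin 4) (Γ : Level V), ∃ (M : CMField) (k : c.K →+* M) (σ' : M →+* ℂ), σ'.comp k = c.σ ∧
        (thetaModelOf hHD hI h₁ h₃ h (embOf hHD hI h₁ h₃) (coverOf hHD hI h₁ h₃ hA) wm (thetaOf _ I) (d12Of μ) (d34Of μ)).Theta V c i Γ ⊆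
          (picardCMUniverse hHD hI h₁ h₃).Uiso Γ M (inflate k (c.Ψ i)) σ')
    (thetaSat : ∀ {L : CMField} {ι₁ : L →+* ℂ} (V : HermSpace3 L ι₁) (c : SeesawCtx L)
      (i : Fin 4) (Γ Γ' : Level V) (hle : Γ' ≤ Γ) (ω : (picardCMUniverse hHD hI h₁ h₃).CohC ((picardCMUniverse hHD hI h₁ h₃).pms L ι₁ V Γ) 1),
      ω ∈ (thetaModelOf hHD hI h₁ h₃ h (embOf hHD hI h₁ h₃) (coverOf hHD hI h₁ h₃ hA) wm (thetaOf _ I) (d12Of μ) (d34Of μ)).Theta V c i Γ →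
        (picardCMUniverse hHD hI h₁ h₃).pullC (coverOf hHD hI h₁ h₃ hA Γ Γ' (Level.Γ_mono hle)) 1 ω ∈ (thetaModelOf hHD hI h₁ h₃ h (embOf hHD hI h₁ h₃) (coverOf hHD hI h₁ h₃ hA) wm (thetaOf _ I) (d12Of μ) (d34Of μ)).Theta V c i Γ')
    (transl : ∀ {L : CMField} {ι₁ : L →+* ℂ} (V : HermSpace3 L ι₁) (c : SeesawCtx L)
      (hc : (thetaModelOf hHD hI h₁ h₃ h (embOf hHD hI h₁ h₃) (coverOf hHD hI h₁ h₃ hA) wm (thetaOf _ I) (d12Of μ) (d34Of μ)).GoodCtx ι₁ c) (hK : Module.finrank ℚ c.K = 6),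
      ∀ γ ∈ (ballOf hHD hI h₁ h₃ V c (two_lt_finrank_of_goodCtx hHD hI h₁ h₃ hc hK)).Δ, ∀ (i : Fin 4) (Γ : Level V) (ω : (picardCMUniverse hHD hI h₁ h₃).CohC ((picardCMUniverse hHD hI h₁ h₃).pms L ι₁ V Γ) 1),
      ω ∈ (thetaModelOf hHD hI h₁ h₃ h (embOf hHD hI h₁ h₃) (coverOf hHD hI h₁ h₃ hA) wm (thetaOf _ I) (d12Of μ) (d34Of μ)).Theta V c i Γ → ∃ (Γ' : Level V) (ω' : (picardCMUniverse hHD hI h₁ h₃).CohC ((picardCMUniverse hHD hI h₁ h₃).pms L ι₁ V Γ') 1),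
        ω' ∈ (thetaModelOf hHD hI h₁ h₃ h (embOf hHD hI h₁ h₃) (coverOf hHD hI h₁ h₃ hA) wm (thetaOf _ I) (d12Of μ) (d34Of μ)).Theta V c i Γ' ∧ (ballOf hHD hI h₁ h₃ V c (two_lt_finrank_of_goodCtx hHD hI h₁ h₃ hc hK)).ev Γ' ω' =
          fun x => (ballOf hHD hI h₁ h₃ V c (two_lt_finrank_of_goodCtx hHD hI h₁ h₃ hc hK)).J γ x *ᵥ (ballOf hHD hI h₁ h₃ V c (two_lt_finrank_of_goodCtx hHD hI h₁ h₃ hc hK)).ev Γ ω (γ • x))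
    (classPacks : ∀ {L : CMField} {ι₁ : L →+* ℂ} (V : HermSpace3 L ι₁) (c : SeesawCtx L),
      (thetaModelOf hHD hI h₁ h₃ h (embOf hHD hI h₁ h₃) (coverOf hHD hI h₁ h₃ hA) wm (thetaOf _ I) (d12Of μ) (d34Of μ)).GoodCtx ι₁ c → Module.finrank ℚ c.K = 6 →
      Nonempty (ClassSupplyPackN (thetaModelOf hHD hI h₁ h₃ h (embOf hHD hI h₁ h₃) (coverOf hHD hI h₁ h₃ hA) wm (thetaOf _ I) (d12Of μ) (d34Of μ)) V c 0) ∧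
        Nonempty (ClassSupplyPackN (thetaModelOf hHD hI h₁ h₃ h (embOf hHD hI h₁ h₃) (coverOf hHD hI h₁ h₃ hA) wm (thetaOf _ I) (d12Of μ) (d34Of μ)) V c 1))
    (gen12 : ∀ {L : CMField} {ι₁ : L →+* ℂ} (V : HermSpace3 L ι₁) (c : SeesawCtx L),
      (thetaModelOf hHD hI h₁ h₃ h (embOf hHD hI h₁ h₃) (coverOf hHD hI h₁ h₃ hA) wm (thetaOf _ I) (d12Of μ) (d34Of μ)).GoodCtx ι₁ c → Module.finrank ℚ c.K = 6 →
      Nonempty ((thetaModelOf hHD hI h₁ h₃ h (embOf hHD hI h₁ h₃) (coverOf hHD hI h₁ h₃ hA) wm (thetaOf _ I) (d12Of μ) (d34Of μ)).Gen12FunBridge V c))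
    (real34 : ∀ {L : CMField} {ι₁ : L →+* ℂ} (V : HermSpace3 L ι₁) (c : SeesawCtx L),
      (thetaModelOf hHD hI h₁ h₃ h (embOf hHD hI h₁ h₃) (coverOf hHD hI h₁ h₃ hA) wm (thetaOf _ I) (d12Of μ) (d34Of μ)).GoodCtx ι₁ c → Module.finrank ℚ c.K = 6 →
      Nonempty ((thetaModelOf hHD hI h₁ h₃ h (embOf hHD hI h₁ h₃) (coverOf hHD hI h₁ h₃ hA) wm (thetaOf _ I) (d12Of μ) (d34Of μ)).Real34FunBridge V c))
    (lin : ∀ {L : CMField} {ι₁ : L →+* ℂ} (V : HermSpace3 L ι₁) (c : SeesawCtx L), (wm V c).LinearStr)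
    (hyp12 : ∀ {L : CMField} {ι₁ : L →+* ℂ} (V : HermSpace3 L ι₁) (c : SeesawCtx L),
      (thetaModelOf hHD hI h₁ h₃ h (embOf hHD hI h₁ h₃) (coverOf hHD hI h₁ h₃ hA) wm (thetaOf _ I) (d12Of μ) (d34Of μ)).GoodCtx ι₁ c → Module.finrank ℚ c.K = 6 →
      Nonempty (((coreOf _ (embOf hHD hI h₁ h₃) (coverOf hHD hI h₁ h₃ hA) wm (thetaOf _ I)).toCore h).HypSmoothCore12
        (((coreOf _ (embOf hHD hI h₁ h₃) (coverOf hHD hI h₁ h₃ hA) wm (thetaOf _ I)).toCore h).side12 (d12Of μ)) (((coreOf _ (embOf hHD hI h₁ h₃) (coverOf hHD hI h₁ h₃ hA) wm (thetaOf _ I)).toCore h).side34 (d34Of μ))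
        ((((coreOf _ (embOf hHD hI h₁ h₃) (coverOf hHD hI h₁ h₃ hA) wm (thetaOf _ I)).toCore h).analyticKM (((coreOf _ (embOf hHD hI h₁ h₃) (coverOf hHD hI h₁ h₃ hA) wm (thetaOf _ I)).toCore h).side12 (d12Of μ))
          (((coreOf _ (embOf hHD hI h₁ h₃) (coverOf hHD hI h₁ h₃ hA) wm (thetaOf _ I)).toCore h).side34 (d34Of μ))).toAnalytic) V c (ℓ := lin V c)))
    (hyp34 : ∀ {L : CMField} {ι₁ : L →+* ℂ} (V : HermSpace3 L ι₁) (c : SeesawCtx L),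
      (thetaModelOf hHD hI h₁ h₃ h (embOf hHD hI h₁ h₃) (coverOf hHD hI h₁ h₃ hA) wm (thetaOf _ I) (d12Of μ) (d34Of μ)).GoodCtx ι₁ c → Module.finrank ℚ c.K = 6 →
      Nonempty (((coreOf _ (embOf hHD hI h₁ h₃) (coverOf hHD hI h₁ h₃ hA) wm (thetaOf _ I)).toCore h).HypSmoothCore34
        (((coreOf _ (embOf hHD hI h₁ h₃) (coverOf hHD hI h₁ h₃ hA) wm (thetaOf _ I)).toCore h).side12 (d12Of μ)) (((coreOf _ (embOf hHD hI h₁ h₃) (coverOf hHD hI h₁ h₃ hA) wm (thetaOf _ I)).toCore h).side34 (d34Of μ))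
        ((((coreOf _ (embOf hHD hI h₁ h₃) (coverOf hHD hI h₁ h₃ hA) wm (thetaOf _ I)).toCore h).analyticKM (((coreOf _ (embOf hHD hI h₁ h₃) (coverOf hHD hI h₁ h₃ hA) wm (thetaOf _ I)).toCore h).side12 (d12Of μ))
          (((coreOf _ (embOf hHD hI h₁ h₃) (coverOf hHD hI h₁ h₃ hA) wm (thetaOf _ I)).toCore h).side34 (d34Of μ))).toAnalytic) V c (ℓ := lin V c))) :
    (picardCMUniverse hHD hI h₁ h₃).PerL :=
  perL_picardCM hHD hI h₁ h₃ hHR h (embOf hHD hI h₁ h₃) (coverOf hHD hI h₁ h₃ hA) wm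
    (thetaOf _ I) (d12Of μ) (d34Of μ)
    (fun V c hc hK => innerEmbAt_of_bettiSide hHD hI h₁ h₃ h (coverOf hHD hI h₁ h₃ hA) wm (thetaOf _ I) (d12Of μ)
      (d34Of μ) V
      ((HermSpace3.isAnisotropic_iff_finrank_ne_two V).2 (two_lt_finrank_of_goodCtx hHD hI h₁ h₃ hc hK).ne')
      (hBetti V))
    (thetaSub_of_hLiu hHD hI h₁ h₃ h hA wm I μ hd ha hLiu)
    (fun V c hc hK => (thetaModelOf hHD hI h₁ h₃ h (embOf hHD hI h₁ h₃) (coverOf hHD hI h₁ h₃ hA) wm (thetaOf _ I) (d12Of μ) (d34Of μ)).exists_cup_ne_zero_of_ballFacts V c (ballOf hHD hI h₁ h₃ V c (two_lt_finrank_of_goodCtx hHD hI h₁ h₃ hc hK))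
      (ballFactsOf hHD hI h₁ h₃ V c _ (thetaModelOf hHD hI h₁ h₃ h (embOf hHD hI h₁ h₃) (coverOf hHD hI h₁ h₃ hA) wm (thetaOf _ I) (d12Of μ) (d34Of μ))
        (thetaSub_of_hLiu hHD hI h₁ h₃ h hA wm I μ hd ha hLiu V c hc hK) (thetaSat V c)
        (fun Γ Γ' hle hV v hv => map_coverOf_unif hHD hI h₁ h₃ hA hle hV hv) (transl V c hc hK))
      (by
        obtain ⟨⟨S₀⟩, ⟨S₁⟩⟩ := classPacks V c hc hK
        exact ⟨S₀.toPairSupplyData.toLineSupplyData.D.supply S₀.toPairSupplyData.toLineSupplyData.res,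
          S₁.toPairSupplyData.toLineSupplyData.D.supply S₁.toPairSupplyData.toLineSupplyData.res⟩))
    gen12 real34
    (occOf hHD hI h₁ h₃ h (embOf hHD hI h₁ h₃) (coverOf hHD hI h₁ h₃ hA) wm (thetaOf _ I) (d12Of μ) (d34Of μ) lin
      hyp12 hyp34)

end Model

end HodgeCM

end
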